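import Mathlib.Analysis.InnerProductSpace.Basic
import Literature.Analysis.FluidPDE.HardSpherePhaseSpace
import Literature.MathematicalPhysics.KineticTheory.HardSphereEuler
import HarnessLib

/-!
# No fast re-collision on the flat torus
# (`LambertianContactSwap.LambertianEuler`, stmt-AtomisticToContinuum-11854, line `Sketch`; lead c10,
# piece W5 `TorusNoFastRecollision`: registered stub `one_sub_two_mul_le_mul_norm_of_recontact`)

Geometric input of lead c10's pathwise charging lemma.  On the unit flat torus `𝕋³ = UnitAddTorus
(Fin 3)` with the torus geometry `Torus.geometry (Fin 3)` (translation `x ↦ x + proj v`,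
minimal-image separation vector `sep(x, y) = reprSym (x − y) ∈ (−1/2, 1/2]³`), let two points
`x, y` be at minimal-image distance `‖sep(x, y)‖ = ε` with a NON-incoming relative velocity,
`⟪sep(x, y), vx − vy⟫ ≥ 0`.  If after a free flight of duration `u > 0` the translated points
`x + proj (u vx)`, `y + proj (u vy)` are again at distance `ε` and INCOMING
(`⟪sep', vx − vy⟫ < 0`), then `1 − 2ε ≤ u ‖vx − vy‖` (`one_sub_two_mul_le_mul_norm_of_recontact`).

Proof (lattice argument).  Put `r₀ = reprSym (x − y)`, `g = vx − vy`, `q = u • g`.  The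
difference of the translated points is `(x − y) + proj q` (`proj` is additive), and both
`reprSym ((x − y) + proj q)` and `r₀ + q` are lifts of this torus point (`proj_reprSym`), so they
differ by a lattice vector: `sep' = r₀ + q + latticeVec k`, `k ∈ ℤ³` (`proj_eq_proj_iff_holds`;
`reprSym_add_proj_eq_add_latticeVec`).
* If `k = 0` then `⟪sep', g⟫ = ⟪r₀, g⟫ + u ‖g‖² ≥ 0`, contradicting the incoming hypothesis.
* If `k ≠ 0` then some coordinate of `latticeVec k` is a nonzero integer, so `‖latticeVec k‖ ≥ 1`
  (`one_le_norm_latticeVec`), while `latticeVec k = sep' − r₀ − q` has norm at most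
  `ε + ε + u ‖g‖`.  Hence `1 ≤ 2ε + u ‖g‖`.

References: Gallagher–Saint-Raymond–Texier 2013, Ch. 4 (introduction: hard spheres on `T^d` with
the distance of nearest images); Bodineau–Gallagher–Saint-Raymond 2016, Appendix B (recollisions in
the torus: lifting to `ℝ^d` modulo `ℤ^d`).  All statements here [folklore].
-/

noncomputable section

namespace Summit.AtomisticToContinuum.HydrodynamicLimit.Theorems.LambertianContactSwapLambertianEulerTorusNoFastRecollision

open scoped BigOperators Topology ENNReal InnerProductSpace
open MeasureTheory ProbabilityTheory Filter Set
open Literature.MathematicalPhysics.KineticTheory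
open Literature.Analysis.FunctionSpaces Literature.Analysis.FunctionSpaces.Torus
open Literature.Analysis.FluidPDE Literature.Analysis.FluidPDE.Torus

/-! ## Two lattice facts -/

/-- **The minimal image of a translate is a lattice translate of the translated minimal image**:
`reprSym (p + proj q) = reprSym p + q + latticeVec k` for some `k ∈ ℤ^d` (both sides are lifts of
the torus point `p + proj q`; `proj_eq_proj_iff_holds`). [folklore] -/
theorem reprSym_add_proj_eq_add_latticeVec {d : Type*} [Fintype d] [DecidableEq d]
    (p : UnitAddTorus d) (q : EuclideanSpace ℝ d) :
    ∃ k : d → ℤ, reprSym (p + proj q) = reprSym p + q + latticeVec k := by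
  have h : proj (reprSym p + q) = proj (reprSym (p + proj q)) := by
    rw [proj_add, proj_reprSym, proj_reprSym]
  exact (proj_eq_proj_iff_holds (reprSym p + q) (reprSym (p + proj q))).1 h

/-- **A nonzero lattice vector has Euclidean norm at least `1`**: some coordinate of
`latticeVec k` is a nonzero integer, and each coordinate is bounded by the Euclidean norm
(`PiLp.norm_apply_le`). [folklore] -/
theorem one_le_norm_latticeVec {d : Type*} [Fintype d] [DecidableEq d] {k : d → ℤ} (hk : k ≠ 0) :
    (1 : ℝ) ≤ ‖latticeVec k‖ := by
  obtain ⟨i, hi⟩ := Function.ne_iff.1 hk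
  have hi' : k i ≠ 0 := hi
  have hki : (1 : ℝ) ≤ |(k i : ℝ)| := by
    rw [← Int.cast_abs]
    exact_mod_cast Int.one_le_abs hi'
  calc (1 : ℝ) ≤ |(k i : ℝ)| := hki
    _ = ‖(latticeVec k) i‖ := by rw [Real.norm_eq_abs, latticeVec_apply]
    _ ≤ ‖latticeVec k‖ := PiLp.norm_apply_le _ i

/-! ## The statement -/

/-- **No fast re-collision on the flat torus.**  On `𝕋³` with the torus geometry
(`translate x v = x + proj v`, `sepVec x y = reprSym (x − y)` the minimal-image vector): if two
points at minimal-image distance `ε` with non-incoming relative velocity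
(`⟪sep, vx − vy⟫ ≥ 0`) fly freely for a time `u > 0` and are then at distance `ε` and incoming
(`⟪sep', vx − vy⟫ < 0`), then `1 − 2ε ≤ u ‖vx − vy‖`: the two lifts differ by a nonzero vector of
`ℤ³`. [folklore] -/
theorem one_sub_two_mul_le_mul_norm_of_recontact :
    ∀ (ε u : ℝ) (x y : T3) (vx vy : V3), 0 < ε → 0 < u →
      ‖(Torus.geometry (Fin 3)).sepVec x y‖ = ε →
      0 ≤ ⟪(Torus.geometry (Fin 3)).sepVec x y, vx - vy⟫_ℝ →
      ‖(Torus.geometry (Fin 3)).sepVec ((Torus.geometry (Fin 3)).translate x (u • vx))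
          ((Torus.geometry (Fin 3)).translate y (u • vy))‖ = ε →
      ⟪(Torus.geometry (Fin 3)).sepVec ((Torus.geometry (Fin 3)).translate x (u • vx))
          ((Torus.geometry (Fin 3)).translate y (u • vy)), vx - vy⟫_ℝ < 0 →
      1 - 2 * ε ≤ u * ‖vx - vy‖ := by
  intro ε u x y vx vy _hε hu h0 hin0 h1 hin1
  simp only [geometry_sepVec, geometry_translate] at h0 hin0 h1 hin1
  -- the difference of the translated points is `(x - y) + proj (u • (vx - vy))`
  have hdiff : x + proj (u • vx) - (y + proj (u • vy)) = (x - y) + proj (u • (vx - vy)) := by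
    have hps : ∀ a b : V3, proj (a - b) = proj a - proj b := fun _ _ => rfl
    rw [smul_sub, hps]
    abel
  rw [hdiff] at h1 hin1
  -- the new separation vector is a lattice translate of `r₀ + u • g`
  obtain ⟨k, hk⟩ := reprSym_add_proj_eq_add_latticeVec (x - y) (u • (vx - vy))
  rw [hk] at h1 hin1
  by_cases hk0 : k = 0
  · -- `k = 0`: the pair moves in a Euclidean chart, where a non-incoming pair stays non-incoming
    exfalso
    rw [hk0, latticeVec_zero, add_zero, inner_add_left, real_inner_smul_left,
      real_inner_self_eq_norm_sq] at hin1
    have hnn : 0 ≤ u * ‖vx - vy‖ ^ 2 := by positivity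
    linarith
  · -- `k ≠ 0`: the lattice vector has norm `≥ 1` and norm `≤ ε + ε + u ‖g‖`
    have hL : (1 : ℝ) ≤ ‖latticeVec k‖ := one_le_norm_latticeVec hk0
    have hq : ‖u • (vx - vy)‖ = u * ‖vx - vy‖ := by
      rw [norm_smul, Real.norm_of_nonneg hu.le]
    have htri : ‖latticeVec k‖ ≤
        ‖reprSym (x - y) + u • (vx - vy) + latticeVec k‖ + ‖reprSym (x - y)‖ +
          ‖u • (vx - vy)‖ := by
      have e : latticeVec k =
          reprSym (x - y) + u • (vx - vy) + latticeVec k - reprSym (x - y) - u • (vx - vy) := by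
        abel
      calc ‖latticeVec k‖
          = ‖reprSym (x - y) + u • (vx - vy) + latticeVec k - reprSym (x - y) - u • (vx - vy)‖ :=
            congrArg norm e
        _ ≤ ‖reprSym (x - y) + u • (vx - vy) + latticeVec k - reprSym (x - y)‖ +
              ‖u • (vx - vy)‖ := norm_sub_le _ _
        _ ≤ ‖reprSym (x - y) + u • (vx - vy) + latticeVec k‖ + ‖reprSym (x - y)‖ +
              ‖u • (vx - vy)‖ := by
            gcongr
            exact norm_sub_le _ _
    rw [h1, h0, hq] at htri
    linarith

end Summit.AtomisticToContinuum.HydrodynamicLimit.Theorems.LambertianContactSwapLambertianEulerTorusNoFastRecollision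

end
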